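import Summits.CriticalPhenomena.PercolationContinuityZ3.Theorems.Transplant.GrigorchukPowerSmallParam
import HarnessLib

/-!
# The PRODUCT FORMULA for walk counts on `Cay(𝔊^k; standard generators)` — walks factor over coordinates (W4 item (3): where `k`-uniformity comes from)

builds on p205010 (kernel theorem, internal audit signed; external expert review pending) — nothing in this file uses p205010; pure graph combinatorics
on W4's graph `Grigorchuk.gkCay k = Cay(𝔊^k; 4k standard generators)` («GrigorchukPowerWitnessConj4Defs» p682559, «GrigorchukPowerSmallParam» p687152).
Lane `prim-bschramm`, seat `prim-bschramm-stmt` gen 41 (port pen) under lead g28's rulings #9320 / #9326 and the design desk's item (3) note (p3 g41 #9318: «k-uniformity = Woess ONCE on the base `stdCay` + the exact multinomial PRODUCT FORMULA for the walk on the power, never Woess on `gkCay`»).  Proof-only helper file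
(`--supports stmt-CriticalPhenomena-4575 --as helper`): NO definition, no `@[conjecture]`, nothing about `θ(p_c)`.

THE FORMULA (closed-walk-COUNT form, no random-walk kernel object — consistent with S-W4-2, «ReturnProbabilityDecayFromGrowth» p687849 and
«GrigorchukWitnessReturnDecay»).  Write `W_G(n)(x, y) := #{walks of length n from x to y in G}` (Mathlib `Fintype.card {p : G.Walk x y // p.length = n}`).
A step of `Cay(𝔊^k; std)` is ONE letter `a, b, c, d` in ONE coordinate («GrigorchukPowerSmallParam» `gkCay_adj_iff`), so a walk of length `n` is a choice of
coordinates `f : Fin n → Fin k` together with, for each coordinate `i`, a walk in `Cay(𝔊; a, b, c, d)` of length `#{t | f t = i}` from `u i` to `v i`: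
**`card_walks_gkCay (k n) (u v) : W_{Cay(𝔊^k)}(n)(u, v) = Σ_{f : Fin n → Fin k} ∏_{i : Fin k} W_{Cay(𝔊)}(#{t | f t = i})(u i, v i)`** (§3, by induction on
`n` over the generic walk recursion `W(n+1)(x, y) = Σ_{w ∼ x} W(n)(w, y)` of §1).  THE SIMPLE-RANDOM-WALK READING (a docstring consequence; degrees `4k` and
`4` by p687152 / p682867): `p⁽ⁿ⁾_{𝔊^k}(u, v) = W_{𝔊^k}(n)(u,v)/(4k)ⁿ = Σ_f k^{−n} ∏_i W_𝔊(N_i(f))(u i, v i)/4^{N_i(f)} = 𝔼[∏_i p^{(N_i)}_𝔊(u i, v i)]` with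
`(N_1, …, N_k)` MULTINOMIAL`(n; 1/k, …, 1/k)` — each step picks a coordinate uniformly and a letter uniformly; given the allocation the coordinates move
independently.  This is the `k`-uniformity device of the W4 line: apply the return-decay fact ONCE on the base `Cay(𝔊)` (k-free constants) and transfer
through this identity, whose `k`-dependence is VISIBLE (the small parameter = allocations with a repeated coordinate, `O(1/k)`, as `1/(2d)` on `ℤ^d`).
SANITY (§4): at `n = 2`, `u = v`: the only allocations with a nonzero product put both steps in one coordinate (`W_𝔊(1)(x,x) = 0`), giving
`W_{𝔊^k}(2)(u,u) = k · W_𝔊(2) = 4k` — p687152's `gkCay_card_walks_length_two_self` recovered from the formula (`card_walks_two_via_product`).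

* §1 GENERIC walk recursion (namespace `WalkCount`, any locally finite graph): `card_walks_eq` (= Mathlib `finsetWalkLength`), `card_walks_zero`
  (`= if x = y then 1 else 0`), **`card_walks_succ`** (`W(n+1)(x,y) = Σ_{w ∈ N(x)} W(n)(w,y)`).
* §2 the recursion on the two Cayley graphs through their letter parametrisations: `card_walks_stdCay_succ` (`Σ` over the four letters),
  `card_walks_gkCay_succ` (`Σ` over `Fin k × {a,b,c,d}`), and the allocation bookkeeping `card_filter_cons`.
* §3 **`card_walks_gkCay`** — the product formula.
* §4 `card_walks_two_via_product` — the `n = 2` sanity instance.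
* §5 `card_closedWalks_gkCay_le` — the BOUND form (base bound `W_𝔊(m)(x,x) ≤ 4^m b(m)` ⇒ `W_{𝔊^k}(n)(u,u) ≤ 4ⁿ Σ_f ∏_i b(N_i(f))`), with
  `sum_card_filter_eq` (`Σ_i N_i(f) = n`).
[cite: Woess2000, §1.B (p⁽ⁿ⁾ and walk counts)] [cite: BenjaminiSchramm1996, §2 (Cayley graphs)]
-/

noncomputable section

namespace Summit.CriticalPhenomena.PercolationContinuityZ3.Theorems.Transplant

open SimpleGraph Finset

/-! ### §1 Generic: the walk recursion in closed form -/

namespace WalkCount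

variable {V : Type*} (G : SimpleGraph V) [DecidableEq V] [G.LocallyFinite]

/-- The number of walks of length `n` from `x` to `y` is the card of Mathlib's `finsetWalkLength`. [folklore] -/
theorem card_walks_eq (n : ℕ) (x y : V) :
    Fintype.card {p : G.Walk x y // p.length = n} = (G.finsetWalkLength n x y).card :=
  G.card_set_walk_length_eq x y n

/-- Walks of length `0`: exactly one if `x = y` (the trivial walk), none otherwise. [folklore] -/
theorem card_walks_zero (x y : V) : Fintype.card {p : G.Walk x y // p.length = 0} = if x = y then 1 else 0 := by
  rw [card_walks_eq]
  unfold finsetWalkLength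
  split_ifs with h
  · subst h; rfl
  · rfl

/-- **The walk recursion**: a walk of length `n+1` from `x` is a first step to a neighbour `w` followed by a walk of length `n` from `w`, and distinct
first steps give distinct walks: `W(n+1)(x, y) = Σ_{w ∈ N(x)} W(n)(w, y)`. [cite: Woess2000, §1.B (p⁽ⁿ⁺¹⁾ = P p⁽ⁿ⁾)] -/
theorem card_walks_succ (n : ℕ) (x y : V) :
    Fintype.card {p : G.Walk x y // p.length = n + 1} = ∑ w ∈ G.neighborFinset x, Fintype.card {p : G.Walk w y // p.length = n} := by
  rw [card_walks_eq]
  have hrec : G.finsetWalkLength (n + 1) x y =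
      Finset.univ.biUnion fun (w : G.neighborSet x) => (G.finsetWalkLength n w y).map ⟨fun p => Walk.cons w.property p, fun _ _ => by simp⟩ := rfl
  rw [hrec, Finset.card_biUnion]
  · simp only [Finset.card_map]
    rw [← Finset.sum_coe_sort (G.neighborFinset x)]
    refine Fintype.sum_equiv ((Equiv.refl _).subtypeEquiv fun w => by simp) _ _ fun w => ?_
    rw [card_walks_eq]
    rfl
  · -- distinct first steps: the second vertex `Walk.snd` separates the pieces
    intro w₁ _ w₂ _ hne
    rw [Function.onFun, Finset.disjoint_left]
    intro p h1 h2
    rw [Finset.mem_map] at h1 h2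
    obtain ⟨q₁, -, rfl⟩ := h1
    obtain ⟨q₂, -, h⟩ := h2
    apply hne
    apply Subtype.ext
    have := congrArg Walk.snd h
    simp only [Function.Embedding.coeFn_mk, Walk.snd_cons] at this
    exact this.symm

end WalkCount

namespace Grigorchuk

open WalkCount
open scoped Classical

/-! ### §2 The recursion on `Cay(𝔊; a,b,c,d)` and `Cay(𝔊^k; std)` through the letters; allocation bookkeeping -/

/-- The four letters exhaust `Letter`. [cite: Grigorchuk1980, definition of a, b, c, d] -/
private theorem mem_letters' (y : Letter) : y ∈ ({Letter.a, .x .b, .x .c, .x .d} : Finset Letter) := by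
  rcases y with _ | ⟨_ | _ | _⟩ <;> simp

/-- The neighbour finset of `x` in `Cay(𝔊; a, b, c, d)`: the four right translates `x·a, x·b, x·c, x·d`. [cite: BenjaminiSchramm1996, §2 (Cayley graphs)] -/
theorem stdCay_neighborFinset (x : ↥grigorchukGroup) :
    stdCay.neighborFinset x = ({Letter.a, .x .b, .x .c, .x .d} : Finset Letter).image (fun y => x * Letter.toG y) := by
  ext w
  rw [mem_neighborFinset, stdCay_adj_iff, Finset.mem_image]
  constructor
  · rintro ⟨y, rfl⟩
    exact ⟨y, mem_letters' y, rfl⟩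
  · rintro ⟨y, -, rfl⟩
    exact ⟨y, rfl⟩

/-- **Walk recursion on `Cay(𝔊; a, b, c, d)` by letters**: `W_𝔊(m+1)(x, z) = Σ_{y ∈ {a,b,c,d}} W_𝔊(m)(x·y, z)`. [cite: Woess2000, §1.B] -/
theorem card_walks_stdCay_succ (m : ℕ) (x z : ↥grigorchukGroup) :
    Fintype.card {p : stdCay.Walk x z // p.length = m + 1} =
      ∑ y ∈ ({Letter.a, .x .b, .x .c, .x .d} : Finset Letter), Fintype.card {p : stdCay.Walk (x * Letter.toG y) z // p.length = m} := by
  rw [card_walks_succ, stdCay_neighborFinset, Finset.sum_image]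
  intro y _ y' _ h
  exact toG_injective (mul_left_cancel h)

/-- **Walk recursion on `Cay(𝔊^k; std)` by (coordinate, letter)**: `W_{𝔊^k}(n+1)(u, v) = Σ_{(j, y) ∈ Fin k × {a,b,c,d}} W_{𝔊^k}(n)(u·e_j(y), v)`.
[cite: Woess2000, §1.B] -/
theorem card_walks_gkCay_succ (k n : ℕ) (u v : GPow k) :
    Fintype.card {p : (gkCay k).Walk u v // p.length = n + 1} =
      ∑ q ∈ (Finset.univ : Finset (Fin k)) ×ˢ ({Letter.a, .x .b, .x .c, .x .d} : Finset Letter),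
        Fintype.card {p : (gkCay k).Walk (u * Pi.mulSingle q.1 (Letter.toG q.2)) v // p.length = n} := by
  rw [card_walks_succ, gkCay_neighborFinset, Finset.sum_image]
  intro q _ q' _ h
  exact mulSingle_toG_injective k (mul_left_cancel h)

/-- **Allocation bookkeeping**: prepending the coordinate `j` to an allocation `f : Fin n → Fin k` raises the count of coordinate `i` by `[i = j]`.
[folklore] -/
theorem card_filter_cons {k n : ℕ} (j : Fin k) (f : Fin n → Fin k) (i : Fin k) :
    (Finset.univ.filter fun t : Fin (n + 1) => (Fin.cons j f : Fin (n + 1) → Fin k) t = i).card =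
      (Finset.univ.filter fun t : Fin n => f t = i).card + if i = j then 1 else 0 := by
  rw [Finset.card_filter, Finset.card_filter, Fin.sum_univ_succ]
  simp only [Fin.cons_zero, Fin.cons_succ]
  rw [add_comm]
  congr 1
  by_cases h : i = j
  · subst h; simp
  · rw [if_neg (Ne.symm h), if_neg h]

/-! ### §3 The product formula -/

/-- **THE PRODUCT FORMULA: walks in `Cay(𝔊^k; std)` factor over coordinates.**  For every `k, n` and `u, v : 𝔊^k`,
`W_{Cay(𝔊^k)}(n)(u, v) = Σ_{f : Fin n → Fin k} ∏_{i : Fin k} W_{Cay(𝔊)}(#{t | f t = i})(u i, v i)` — a walk is an allocation of its `n` steps to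
coordinates together with one walk per coordinate of the allocated length.  Simple-random-walk reading: `p⁽ⁿ⁾_{𝔊^k}(u,v) = 𝔼[∏_i p^{(N_i)}_𝔊(u i, v i)]`,
`(N_i)` multinomial`(n; 1/k, …, 1/k)`. [cite: Woess2000, §1.B (p⁽ⁿ⁾ and walk counts)] -/
theorem card_walks_gkCay (k n : ℕ) (u v : GPow k) :
    Fintype.card {p : (gkCay k).Walk u v // p.length = n} =
      ∑ f : Fin n → Fin k, ∏ i : Fin k, Fintype.card {p : stdCay.Walk (u i) (v i) // p.length = (Finset.univ.filter fun t => f t = i).card} := by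
  induction n generalizing u with
  | zero =>
    rw [card_walks_zero, Fintype.sum_unique]
    simp only [Finset.univ_eq_empty, Finset.filter_empty, Finset.card_empty, card_walks_zero]
    rw [Fintype.prod_boole]
    by_cases h : u = v
    · subst h; simp
    · have h' : ¬ ∀ i, u i = v i := fun h' => h (funext h')
      rw [if_neg h, if_neg h']
  | succ n ih =>
    -- LHS: first step = one letter `y` in one coordinate `j`, then the product formula for the rest (IH)
    rw [card_walks_gkCay_succ, Finset.sum_product]
    simp only [ih]
    -- RHS: split the allocation `f' = Fin.cons j f`
    rw [← Fintype.sum_equiv (Fin.consEquiv fun _ : Fin (n + 1) => Fin k) (fun q => ∏ i : Fin k,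
        Fintype.card {p : stdCay.Walk (u i) (v i) // p.length = (Finset.univ.filter fun t => (Fin.cons q.1 q.2 : Fin (n + 1) → Fin k) t = i).card})
        _ (fun q => rfl), Fintype.sum_prod_type]
    refine Finset.sum_congr rfl fun j _ => ?_
    rw [Finset.sum_comm]
    refine Finset.sum_congr rfl fun f _ => ?_
    -- for fixed `j`, `f`: sum over the letter `y` of the product = the product with coordinate `j` advanced by one step
    simp only [card_filter_cons]
    -- split both products at `i = j`
    rw [← Finset.mul_prod_erase Finset.univ _ (Finset.mem_univ j), if_pos rfl]
    have hR : ∏ i ∈ Finset.univ.erase j, Fintype.card {p : stdCay.Walk (u i) (v i) //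
        p.length = (Finset.univ.filter fun t => f t = i).card + if i = j then 1 else 0} =
        ∏ i ∈ Finset.univ.erase j, Fintype.card {p : stdCay.Walk (u i) (v i) // p.length = (Finset.univ.filter fun t => f t = i).card} := by
      refine Finset.prod_congr rfl fun i hi => ?_
      rw [if_neg (Finset.ne_of_mem_erase hi), add_zero]
    rw [hR]
    have hL : ∀ y : Letter, ∏ i : Fin k, Fintype.card {p : stdCay.Walk ((u * Pi.mulSingle j (Letter.toG y) : GPow k) i) (v i) //
        p.length = (Finset.univ.filter fun t => f t = i).card} =
        Fintype.card {p : stdCay.Walk (u j * Letter.toG y) (v j) // p.length = (Finset.univ.filter fun t => f t = j).card} *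
          ∏ i ∈ Finset.univ.erase j, Fintype.card {p : stdCay.Walk (u i) (v i) // p.length = (Finset.univ.filter fun t => f t = i).card} := by
      intro y
      rw [← Finset.mul_prod_erase Finset.univ _ (Finset.mem_univ j), Pi.mul_apply, Pi.mulSingle_eq_same]
      congr 1
      refine Finset.prod_congr rfl fun i hi => ?_
      rw [Pi.mul_apply, Pi.mulSingle_eq_of_ne (Finset.ne_of_mem_erase hi), mul_one]
    simp only [hL]
    rw [← Finset.sum_mul, card_walks_stdCay_succ]

/-! ### §4 Sanity: the formula recovers `W_{𝔊^k}(2)(u, u) = 4k` -/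

/-- **Sanity instance of the product formula at `n = 2`**: combined with p687152's direct count, `Σ_{f : Fin 2 → Fin k} ∏_i W_𝔊(#{t | f t = i})(u i, u i)
= 4k` (the closed two-step walks; SRW: `p₂ = 4k/(4k)² = 1/(4k)`). [cite: Woess2000, §1.B] -/
theorem card_walks_two_via_product (k : ℕ) (u : GPow k) :
    (∑ f : Fin 2 → Fin k, ∏ i : Fin k, Fintype.card {p : stdCay.Walk (u i) (u i) // p.length = (Finset.univ.filter fun t => f t = i).card}) = 4 * k := by
  rw [← card_walks_gkCay, gkCay_card_walks_length_two_self]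

/-! ### §5 The bound form the item-(3) consumer uses (design desk p3 g41 #9337) -/

/-- The allocation counts sum to the number of steps: `Σ_i #{t | f t = i} = n`. [folklore] -/
theorem sum_card_filter_eq {k n : ℕ} (f : Fin n → Fin k) :
    ∑ i : Fin k, (Finset.univ.filter fun t : Fin n => f t = i).card = n := by
  rw [← Finset.card_eq_sum_card_fiberwise fun t _ => Finset.mem_univ (f t), Finset.card_univ, Fintype.card_fin]

/-- **BOUND FORM of the product formula** (what `UniformPolygons` / the small-parameter tail consume): if the closed-walk counts of the base graph satisfy
`W_𝔊(m)(x, x) ≤ 4^m · b(m)` for all `m`, `x` (no sign condition on `b` needed; e.g. `b(m) = C₁ e^{−C₂ m^γ}` from «GrigorchukWitnessReturnDecay» p688051 — k-FREE constants), then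
`W_{𝔊^k}(n)(u, u) ≤ 4ⁿ · Σ_{f : Fin n → Fin k} ∏_i b(#{t | f t = i})`, i.e. `p⁽ⁿ⁾_{𝔊^k}(u,u) ≤ k^{−n} Σ_f ∏_i b(N_i(f)) = 𝔼[∏_i b(N_i)]` — the
`k`-dependence sits entirely in the visible allocation sum. [cite: Woess2000, §1.B (p⁽ⁿ⁾ and walk counts)] -/
theorem card_closedWalks_gkCay_le (k n : ℕ) (u : GPow k) (b : ℕ → ℝ)
    (hb : ∀ (m : ℕ) (x : ↥grigorchukGroup), (Fintype.card {p : stdCay.Walk x x // p.length = m} : ℝ) ≤ 4 ^ m * b m) :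
    (Fintype.card {p : (gkCay k).Walk u u // p.length = n} : ℝ) ≤
      4 ^ n * ∑ f : Fin n → Fin k, ∏ i : Fin k, b ((Finset.univ.filter fun t => f t = i).card) := by
  rw [card_walks_gkCay, Nat.cast_sum, Finset.mul_sum]
  refine Finset.sum_le_sum fun f _ => ?_
  rw [Nat.cast_prod]
  calc ∏ i : Fin k, (Fintype.card {p : stdCay.Walk (u i) (u i) // p.length = (Finset.univ.filter fun t => f t = i).card} : ℝ)
      ≤ ∏ i : Fin k, (4 : ℝ) ^ (Finset.univ.filter fun t => f t = i).card * b ((Finset.univ.filter fun t => f t = i).card) :=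
        Finset.prod_le_prod (fun i _ => Nat.cast_nonneg _) fun i _ => hb _ (u i)
    _ = 4 ^ n * ∏ i : Fin k, b ((Finset.univ.filter fun t => f t = i).card) := by
        rw [Finset.prod_mul_distrib, Finset.prod_pow_eq_pow_sum, sum_card_filter_eq]

end Grigorchuk

end Summit.CriticalPhenomena.PercolationContinuityZ3.Theorems.Transplant

end
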